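import Summits.AtomisticToContinuum.Crystallization.Theorems.FreeSplittingCertificatesStrictSplittingRuleHcpFamilyMinExists
import Summits.AtomisticToContinuum.Crystallization.Theorems.FreeSplittingCertificatesStrictSplittingRuleHcpFamilyMinLocalised

/-!
# `StrictSplittingRule` (stmt-AtomisticToContinuum-12560), line `birth`: the coarse-gap stub contains crux r2

LADDER FACT recorded by the lead: the line's load-bearing stub S1 `stub_coarseGapCertificate` (a feasible
finite-range rule GAPPED at one coarse tolerance, at the hcp-family minimiser) implies the route's crux r2
`FiniteRangeSplitting` (stmt-AtomisticToContinuum-12559) outright — the family minimiser exists and is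
`1 %`-ideal by the landed S0a/S0b (`stub_hcpFamilyMinExists`, `stub_hcpFamilyMinLocalised`), and
feasibility is literally r2's conclusion (`finiteRangeSplitting_iff` is `Iff.rfl`).  So S1 is at least
crux-sized: any proof of S1 proves r2, any refutation of r2 refutes S1 (and the crux, by `Ladder`).
Registered anchor: `stub_coarseGapGivesR2`.  Pure logic, [folklore].
-/

noncomputable section

namespace Summit.AtomisticToContinuum.Crystallization.Theorems.StrictSplittingRuleBirth

open scoped BigOperators Classical
open Literature.MathematicalPhysics.StatisticalMechanics
open Literature.Geometry.DiscreteGeometry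

/-- Euclidean `3`-space. -/
local notation "E3" => EuclideanSpace ℝ (Fin 3)

/-- Crux r2 packaged in the line's vocabulary (`Iff.rfl`). -/
theorem finiteRangeSplitting_iff :
    Summit.AtomisticToContinuum.Crystallization.Theses.FreeSplittingCertificates.FiniteRangeSplitting ↔
      ∀ δ : ℝ, 0 < δ → ∃ (R : ℝ) (Φ : E3 → Finset E3 → ℝ), 0 < R ∧ IsRule Φ ∧ Feasible δ R Φ :=
  Iff.rfl

/-- S0 (landed S0a + S0b): the hcp family has a `1 %`-ideal global minimiser. -/
theorem hcpFamilyMinimiser_holds :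
    ∃ a h t : ℝ, 0 < a ∧ |t| ≤ 1 / 100 ∧ h = (1 + t) * a * Real.sqrt (2 / 3) ∧ HcpFamilyMin a h := by
  obtain ⟨a, h, ha, hh, hmin⟩ := stub_hcpFamilyMinExists
  have hs : 0 < Real.sqrt (2 / 3) := Real.sqrt_pos.mpr (by norm_num)
  have has : a * Real.sqrt (2 / 3) ≠ 0 := (mul_pos ha hs).ne'
  refine ⟨a, h, h / (a * Real.sqrt (2 / 3)) - 1, ha, stub_hcpFamilyMinLocalised a h ha hh hmin, ?_, hmin⟩
  field_simp
  ring

/-- **The coarse-gap stub implies crux r2 `FiniteRangeSplitting`** (at every hard core: take the stub's rule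
at radius `max R₀ 1` and forget the gap). -/
theorem finiteRangeSplitting_of_coarseGap
    (h1 : ∀ δ : ℝ, 0 < δ → ∀ a h t : ℝ, 0 < a → |t| ≤ 1 / 100 → h = (1 + t) * a * Real.sqrt (2 / 3) →
      HcpFamilyMin a h → ∃ η₀ : ℝ, 0 < η₀ ∧ η₀ ≤ a / 100 ∧ ∃ R₀ : ℝ, ∀ R : ℝ, R₀ ≤ R →
        ∃ (Φ : E3 → Finset E3 → ℝ) (c₀ : ℝ), IsRule Φ ∧ 0 < c₀ ∧ Feasible δ R Φ ∧
          ∀ (N : ℕ) (x : Fin N → E3), Sep δ x → ∀ k : Fin N,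
            siteE R Φ x k < eInf + c₀ → ShellCloseTo η₀ (shell a x k) (target a t)) :
    Summit.AtomisticToContinuum.Crystallization.Theses.FreeSplittingCertificates.FiniteRangeSplitting := by
  rw [finiteRangeSplitting_iff]
  intro δ hδ
  obtain ⟨a, h, t, ha, ht, hht, hmin⟩ := hcpFamilyMinimiser_holds
  obtain ⟨η₀, -, -, R₀, hR₀⟩ := h1 δ hδ a h t ha ht hht hmin
  obtain ⟨Φ, c₀, hrule, -, hfeas, -⟩ := hR₀ (max R₀ 1) (le_max_left _ _)
  exact ⟨max R₀ 1, Φ, lt_of_lt_of_le one_pos (le_max_right _ _), hrule, hfeas⟩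

/-- **Registered anchor `stub_coarseGapGivesR2`**: the registered S1 signature implies crux r2. -/
theorem stub_coarseGapGivesR2 :
    (∀ δ : ℝ, 0 < δ → ∀ a h t : ℝ, 0 < a → |t| ≤ 1 / 100 → h = (1 + t) * a * Real.sqrt (2 / 3) →
      HcpFamilyMin a h → ∃ η₀ : ℝ, 0 < η₀ ∧ η₀ ≤ a / 100 ∧ ∃ R₀ : ℝ, ∀ R : ℝ, R₀ ≤ R →
        ∃ (Φ : E3 → Finset E3 → ℝ) (c₀ : ℝ), IsRule Φ ∧ 0 < c₀ ∧ Feasible δ R Φ ∧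
          ∀ (N : ℕ) (x : Fin N → E3), Sep δ x → ∀ k : Fin N,
            siteE R Φ x k < eInf + c₀ → ShellCloseTo η₀ (shell a x k) (target a t)) →
    Summit.AtomisticToContinuum.Crystallization.Theses.FreeSplittingCertificates.FiniteRangeSplitting :=
  finiteRangeSplitting_of_coarseGap

end Summit.AtomisticToContinuum.Crystallization.Theorems.StrictSplittingRuleBirth

end
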